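import Summits.Ventures.QEC.CircuitDistance.PortK2DataBB144Z
import Summits.Ventures.QEC.CircuitDistance.K2Chunks
import HarnessLib

/-!
# K2(`[[144,12,12]]`) chunk module — COMPUTATIONAL (native_decide; `Lean.ofReduceBool`)

Cell `qec`, CDX, R146/R152 STEP 1 («computational» header; `ofReduceBool` confined to these chunk modules). Checker of record
`K2.K2Data` (qec-cdx-type-1, PortK2Check); data module of record `PortK2DataBB144X/Z` (p669158/9, crit-1 data audit PASS
2026-08-28T21:20Z); chunk glue `K2Chunks` (idea-1 g2). Cube 0, child 15: leaf group 2 of 5.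
Leaf theorems: the K2 DFS accepts below one descendant state of pivot cube 0 (sector Z); sizes are exact DFS visit counts
(eng-1 g2 `k2count.c`), capped so that the gate's native-axiom audit re-verifies every leaf in place. Assemblies re-derive the
child lists in the kernel (`decide`) and end in the literal cube fact `d144Z.cube (Ts144Z.getD 0 []) (0) (lives144Z.getD 0 0) = true`
(the `hcubes` hypothesis of `K2Inst.k2_complete`). Emitted by qec-cdx-eng-1 g2 (`gen2.py`, idea-1's `gen_k2chunks_from_lean.py` lineage).
-/

namespace Summit.Ventures.QEC.CircuitDistance.K2

set_option maxRecDepth 100000 in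
set_option maxHeartbeats 0 in
set_option exponentiation.threshold 1024 in
/-- K2(144) chunk fact `cube144Z0_ch15_3` (632627 DFS visits; see the module docstring). -/
theorem cube144Z0_ch15_3 : app5 (d144Z.dfs (Ts144Z.getD 0 []) 6) (2361201255834473989376, 488, 1809251394333065553493296640760748560207343510400643484523081667157040300033, 3, 2348542582773833227889480596789335189854296659006109231563358087344093533209647880056795529743715086463139804) = true := by native_decide

set_option maxRecDepth 100000 in
set_option maxHeartbeats 0 in
set_option exponentiation.threshold 1024 in
/-- K2(144) chunk fact `cube144Z0_ch15_4` (683533 DFS visits; see the module docstring). -/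
theorem cube144Z0_ch15_4 : app5 (d144Z.dfs (Ts144Z.getD 0 []) 6) (18014399651400704, 2536, 1809251394333065553493296640760748560207343510401252783136167440261092212737, 3, 2348542582773833227889480596789335189854296659006109231563358087344093533209647879437825510101024949013577692) = true := by native_decide

set_option maxRecDepth 100000 in
set_option maxHeartbeats 0 in
set_option exponentiation.threshold 1024 in
/-- K2(144) chunk fact `cube144Z0_ch15_5` (231618 DFS visits; see the module docstring). -/
theorem cube144Z0_ch15_5 : app5 (d144Z.dfs (Ts144Z.getD 0 []) 6) (299818208362822108160, 1896, 1809251394333065553493296640761105372130520000370898384608887123907738337281, 3, 2348542582773833227889480596789335189854296659006109231563358086987281610033157909173254017738651164917891036) = true := by native_decide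

set_option maxRecDepth 100000 in
set_option maxHeartbeats 0 in
set_option exponentiation.threshold 1024 in
/-- K2(144) chunk fact `cube144Z0_ch15_6` (279064 DFS visits; see the module docstring). -/
theorem cube144Z0_ch15_6 : app5 (d144Z.dfs (Ts144Z.getD 0 []) 6) (2379684591655155926272, 488, 1809251394333065553493296640763603055592755430162750385055423740396408143873, 3, 2348542582773833227889480596789335189854296659006109231563358084132786224621238147056682078839660892152397788) = true := by native_decide

set_option maxRecDepth 100000 in
set_option maxHeartbeats 0 in
set_option exponentiation.threshold 1024 in
/-- K2(144) chunk fact `cube144Z0_ch15_7` (304875 DFS visits; see the module docstring). -/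
theorem cube144Z0_ch15_7 : app5 (d144Z.dfs (Ts144Z.getD 0 []) 6) (1182951506923295362048, 2536, 1809251394333065553493296640943436264873706375176094417206060127580634218497, 3, 2348542582773833227889480596789335189854296659006109231563357901445081558258373371596077989304283435160829916) = true := by native_decide
end Summit.Ventures.QEC.CircuitDistance.K2
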